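import Summits.AtomisticToContinuum.HydrodynamicLimit.Theorems.ImplosionDichotomyHydroLimitInBandCubicChannelS
import Summits.AtomisticToContinuum.HydrodynamicLimit.Theorems.ImplosionDichotomyHydroLimitInBandBandShiftStatics
import Summits.AtomisticToContinuum.HydrodynamicLimit.Theorems.ImplosionDichotomyHydroLimitInBandKineticInstanceOrth
import Summits.AtomisticToContinuum.HydrodynamicLimit.Theorems.ImplosionDichotomyHydroLimitInBandWindowClauseS
import Summits.AtomisticToContinuum.HydrodynamicLimit.Theorems.OneFlightGossipEngineClampedTransferDockOfInputs
import Summits.AtomisticToContinuum.HydrodynamicLimit.Theorems.OneFlightGossipEngineClampedTransferDockSeet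
import HarnessLib

/-!
# The crux `HydroLimitInBand` from the five SIGNED inputs (binder candidate; line `IdeatorOneSketch` v16, stmt-AtomisticToContinuum-9133)

Support file (`--supports stmt-AtomisticToContinuum-9133`, registered sub-goal `hydroLimitInBand_of_signedInputs`). The binder
`ClampedTransferDockOfInputs` (stmt-17733, closed) has become vacuous: its antecedent `BandCoherenceLDAlongFamilies` (stmt-17700) is refuted
(Galilean-boost witness). Skeleton v16 of the line re-threads the landed rate dock around it (signed band remainder, repair R1); with its four
provable stubs LANDED — `HydroLimitInBandCubicChannelS.stub_cubicChannelRateS` (p146424), `stub_bandShiftStatics`, `stub_kineticInstanceOrth`,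
`stub_windowClauseRateS` — the crux follows from FIVE conjecture-grade inputs, four of them route items:

`hydroLimitInBand_of_signedInputs : SEET (stmt-17701) → KCWF-Q → LCT (stmt-17691) → EAT (stmt-17703) → CAT (stmt-13734) → HydroLimitInBand`,

KCWF-Q = `HydroLimitInBandSignedBand.KineticCurrentsLDAlongFamiliesQ` (to be filed as the item replacing 17700; it implies KCWF = stmt-16659 by
the landed `kcwf_of_kcwfQ`). This is `HydroLimitInBand_of` of the skeleton with its two non-provable stubs as hypotheses — the new binder the
planner can re-bind `closes` to; `clampedTransferDock_of_signedInputs` is the same composition typed as the sibling dock `ClampedTransferDock`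
(stmt-17615) for that seat. Quantifier plumbing over landed theorems only. [cite: Yau1991, §2]

prover-line-stmt-AtomisticToContinuum-9133-c17-0 (lead, line cycle 18).
-/

noncomputable section

namespace Summit.AtomisticToContinuum.HydrodynamicLimit.Theorems.HydroLimitInBandSignedBand

open Summit.AtomisticToContinuum.HydrodynamicLimit.Theses
open Summit.AtomisticToContinuum.HydrodynamicLimit.Theorems

/-- **The crux from the five signed inputs** (registered sub-goal `hydroLimitInBand_of_signedInputs`, line IdeatorOneSketch v16): KCWF from
KCWF-Q (`kcwf_of_kcwfQ`); ECT from SEET (`ClampedTransferDockSeet.seet_imp_energyCurrentTails`, p141132); the D-shape one-window ledger by the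
signed window clause over the landed window estimate (p136014), the signed cubic channel (p146424), the band statics and the orthogonal KC1;
window continuity (p118327); the guarded Grönwall core by `stub_ledgerEndD` (p139514) with the a-priori bound (p109679); reduction (p97252)
and dock (p97115). `ImplosionDichotomy.HydroLimitInBand` is the re-typed conjunct `HydrodynamicLimit` (same term). [cite: Yau1991, §2] -/
theorem hydroLimitInBand_of_signedInputs : OneFlightGossipEngine.SuperExponentialEnergyTails → KineticCurrentsLDAlongFamiliesQ →
    OneFlightGossipEngine.LocalClampedTransferLDAlongFamilies → OneFlightGossipEngine.EnergyActivityTails →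
    OneFlightGossipEngine.CollisionActivityTails → ImplosionDichotomy.HydroLimitInBand := by
  intro hS hQ hL hE hC
  have hK : HydroLimitInBandOfHeart.KineticCurrentsWindowLDFamily := kcwf_of_kcwfQ hQ
  have h₆ : OneFlightGossipEngine.EnergyCurrentTails := ClampedTransferDockSeet.seet_imp_energyCurrentTails hS
  have hOW := HydroLimitInBandWindowClauseS.stub_windowClauseRateS ClampedTransferDockRate.stub_windowEstimateRate
    HydroLimitInBandCubicChannelS.stub_cubicChannelRateS HydroLimitInBandBandShift.stub_bandShiftStatics
    HydroLimitInBandKineticInstanceOrth.stub_kineticInstanceOrth hQ hS hL hE hK hC h₆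
  have hWC : ClampedCurrentsDockFromWindows.WindowContinuityInBand := HydroLimitInBandContinuity.stub_windowContinuityInBand hC hE h₆
  have hG : HydroLimitInBandOfHeart.GronwallCoreInBand :=
    ClampedTransferDockLedgerEndD.stub_ledgerEndD hOW hWC EntropyClockDock.ledgerAprioriBound
  exact Theorems.hydroLimitInBand_of_relEntropyVanishingInBand (EntropyClockDock.relEntropyVanishingInBand_of_gronwallCoreInBand hG)

/-- **The same binder with KCWF-Q read as a term of route OneFlightGossipEngine's vocabulary for the four items and `_root_.HydrodynamicLimit`
as the conclusion** (the crux `ImplosionDichotomy.HydroLimitInBand` unfolds to it): the shape a re-bound `closes` glue would have. [cite: Yau1991, §2] -/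
theorem hydrodynamicLimit_of_signedInputs (hS : OneFlightGossipEngine.SuperExponentialEnergyTails) (hQ : KineticCurrentsLDAlongFamiliesQ)
    (hL : OneFlightGossipEngine.LocalClampedTransferLDAlongFamilies) (hE : OneFlightGossipEngine.EnergyActivityTails)
    (hC : OneFlightGossipEngine.CollisionActivityTails) : _root_.HydrodynamicLimit :=
  hydroLimitInBand_of_signedInputs hS hQ hL hE hC

/-- **The sibling dock `ClampedTransferDock` (stmt-AtomisticToContinuum-17615, route OneFlightGossipEngine) from the signed inputs**: the same
composition read as the dock's own statement (`KCWF → CAT → ECT → HydrodynamicLimit`), for the 17615 seat — SEET, KCWF-Q, LCT, EAT in place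
of SEET, BCL, LCT, EAT of the landed `ClampedTransferDockSketch.clampedTransferDock_of_inputs` (whose BCL is refuted). [cite: Yau1991, §2] -/
theorem clampedTransferDock_of_signedInputs : OneFlightGossipEngine.SuperExponentialEnergyTails → KineticCurrentsLDAlongFamiliesQ →
    OneFlightGossipEngine.LocalClampedTransferLDAlongFamilies → OneFlightGossipEngine.EnergyActivityTails →
    OneFlightGossipEngine.ClampedTransferDock := by
  intro hS hQ hL hE hK hC h₆
  have hKF : HydroLimitInBandOfHeart.KineticCurrentsWindowLDFamily := hK
  have hOW := HydroLimitInBandWindowClauseS.stub_windowClauseRateS ClampedTransferDockRate.stub_windowEstimateRate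
    HydroLimitInBandCubicChannelS.stub_cubicChannelRateS HydroLimitInBandBandShift.stub_bandShiftStatics
    HydroLimitInBandKineticInstanceOrth.stub_kineticInstanceOrth hQ hS hL hE hKF hC h₆
  have hWC : ClampedCurrentsDockFromWindows.WindowContinuityInBand := HydroLimitInBandContinuity.stub_windowContinuityInBand hC hE h₆
  have hG : HydroLimitInBandOfHeart.GronwallCoreInBand :=
    ClampedTransferDockLedgerEndD.stub_ledgerEndD hOW hWC EntropyClockDock.ledgerAprioriBound
  exact Theorems.hydroLimitInBand_of_relEntropyVanishingInBand (EntropyClockDock.relEntropyVanishingInBand_of_gronwallCoreInBand hG)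

end Summit.AtomisticToContinuum.HydrodynamicLimit.Theorems.HydroLimitInBandSignedBand

end
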